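import Summits.KontsevichZagierPeriods.Zeta5Search.TwoTaleLineBoundBlocks
import Literature.NumberTheory.Irrationality.Zudilin2014.FirstTaleComplex

/-!
# Line-bound blocks for a general first-tale point: `log ‖R(a,b; u+iy)‖` in closed form

HONEST FRAMING: systematic search; no irrationality claim unless certified.

Cell pub-zeta5, T3 service (P1 g9).  The rung-independent version of `TwoTaleP15LineBoundNorm`: for admissible
`a b : Fin 4 → ℤ` and the Literature's complex `Zudilin2014.RC a b s = Π(a,b)·num(s)/den(s)`, at `s = u + iy`, `y ≠ 0`:
* **`log_norm_RC_eq`** — `log ‖R(u+iy)‖ = log|Π| + Σ_{j≤3} Σ_{i∈[b_j,a_j)} halfLog y (u+i) − Σ_{i∈[a₄,b₄)} halfLog y (u+i)`;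
* **`log_norm_RC_le`** — every numerator block replaced by its integral in closed form (`TwoTaleLineBound.prim`) plus the
  two endpoint values plus `1 + log 2`, the denominator block by its integral from one node to the left
  (`sum_halfLog_le` / `le_sum_halfLog`); hypotheses `b_j + 2 ≤ a_j` (blocks of length ≥ 2) and `1 ≤ u + a₄`.
Any rung (P15: `aP15/bP15`; rung A: `aRungA/bRungA`) instantiates it.  Not here: Stirling for `Π`, the `η`-certificate,
the `dy`-assembly.
-/

noncomputable section

open Real Finset Complex Polynomial
open Literature.NumberTheory.Irrationality.Zudilin2014

namespace Summit.KontsevichZagierPeriods.Zeta5Search.TwoTaleLineBound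

variable {y : ℝ}

/-- `log ‖(u+iy) + i‖ = halfLog y (u+i)` for an integer shift `i` (`y ≠ 0`). -/
theorem log_norm_factor_int (hy : y ≠ 0) (u : ℝ) (i : ℤ) :
    Real.log ‖((u : ℂ) + (y : ℂ) * I) + (i : ℂ)‖ = halfLog y (u + i) := by
  have h : ((u : ℂ) + (y : ℂ) * I) + (i : ℂ) = ((u + i : ℝ) : ℂ) + (y : ℂ) * I := by push_cast; ring
  rw [h, Complex.norm_add_mul_I, Real.sqrt_eq_rpow, halfLog, ← Real.sqrt_eq_rpow, Real.log_sqrt (sq_add_sq_pos hy _).le]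

/-- The factors are nonzero for `y ≠ 0`. -/
theorem factor_int_ne_zero (hy : y ≠ 0) (u : ℝ) (i : ℤ) : ((u : ℂ) + (y : ℂ) * I) + (i : ℂ) ≠ 0 := by
  intro h
  have := congrArg Complex.im h
  simp at this
  exact hy this

/-- `log ‖aeval (u+iy) (block lo hi)‖ = Σ_{i ∈ [lo,hi)} halfLog y (u+i)`. -/
theorem log_norm_aeval_block (hy : y ≠ 0) (u : ℝ) (lo hi : ℤ) :
    Real.log ‖aeval ((u : ℂ) + (y : ℂ) * I) (block lo hi)‖ = ∑ i ∈ Ico lo hi, halfLog y (u + i) := by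
  rw [aeval_block_complex, norm_prod, Real.log_prod]
  · exact sum_congr rfl fun i _ => log_norm_factor_int hy u i
  · intro i _; exact norm_ne_zero_iff.2 (factor_int_ne_zero hy u i)

/-- `aeval (u+iy) (block lo hi) ≠ 0` for `y ≠ 0`. -/
theorem aeval_block_ne_zero (hy : y ≠ 0) (u : ℝ) (lo hi : ℤ) : aeval ((u : ℂ) + (y : ℂ) * I) (block lo hi) ≠ 0 := by
  rw [aeval_block_complex]
  exact prod_ne_zero_iff.2 fun i _ => factor_int_ne_zero hy u i

/-- **`log ‖R(a,b; u+iy)‖` as block sums** (exact, `y ≠ 0`). -/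
theorem log_norm_RC_eq (hy : y ≠ 0) (a b : Fin 4 → ℤ) (u : ℝ) :
    Real.log ‖RC a b ((u : ℂ) + (y : ℂ) * I)‖ =
      Real.log |Pi a b| + (∑ i ∈ Ico (b 0) (a 0), halfLog y (u + i)) + (∑ i ∈ Ico (b 1) (a 1), halfLog y (u + i))
        + (∑ i ∈ Ico (b 2) (a 2), halfLog y (u + i)) - (∑ i ∈ Ico (a 3) (b 3), halfLog y (u + i)) := by
  unfold RC num den
  set s : ℂ := (u : ℂ) + (y : ℂ) * I with hs
  have hPi : ‖((Pi a b : ℚ) : ℂ)‖ = |(Pi a b : ℝ)| := by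
    rw [show ((Pi a b : ℚ) : ℂ) = ((Pi a b : ℝ) : ℂ) by norm_cast, Complex.norm_real, Real.norm_eq_abs]
  have hPi0 : |(Pi a b : ℝ)| ≠ 0 := abs_ne_zero.2 (by exact_mod_cast Pi_ne_zero a b)
  have hB := fun lo hi => norm_ne_zero_iff.2 (aeval_block_ne_zero hy u lo hi)
  rw [map_mul, map_mul, norm_div, norm_mul, norm_mul, norm_mul, hPi,
    Real.log_div (mul_ne_zero hPi0 (mul_ne_zero (mul_ne_zero (hB _ _) (hB _ _)) (hB _ _))) (hB _ _),
    Real.log_mul hPi0 (mul_ne_zero (mul_ne_zero (hB _ _) (hB _ _)) (hB _ _)),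
    Real.log_mul (mul_ne_zero (hB _ _) (hB _ _)) (hB _ _), Real.log_mul (hB _ _) (hB _ _),
    log_norm_aeval_block hy, log_norm_aeval_block hy, log_norm_aeval_block hy, log_norm_aeval_block hy]
  ring

/-- An integer block sum as a `range` sum from the base point `u + lo` (`lo < hi`). -/
theorem sum_IcoInt_halfLog (y u : ℝ) {lo hi : ℤ} (h : lo < hi) :
    ∑ i ∈ Ico lo hi, halfLog y (u + i) = ∑ i ∈ range ((hi - 1 - lo).toNat + 1), halfLog y ((u + lo) + i) := by
  have e : Ico lo hi = (range ((hi - 1 - lo).toNat + 1)).map ⟨fun k : ℕ => lo + k, fun x y hxy => by simpa using hxy⟩ := by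
    ext z
    simp only [mem_Ico, mem_map, mem_range, Function.Embedding.coeFn_mk]
    constructor
    · intro hz; exact ⟨(z - lo).toNat, by omega, by omega⟩
    · rintro ⟨k, hk, rfl⟩; omega
  rw [e, sum_map]
  refine sum_congr rfl fun k _ => ?_
  simp only [Function.Embedding.coeFn_mk]
  push_cast; ring_nf

/-- **Closed-form upper bound for `log ‖R(a,b; u+iy)‖`** (`y ≠ 0`; numerator blocks of length `≥ 2`; `1 ≤ u + a₄`). -/
theorem log_norm_RC_le (hy : y ≠ 0) {a b : Fin 4 → ℤ} (hlen : ∀ j : Fin 4, j ≠ 3 → b j + 2 ≤ a j)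
    (hden : a 3 < b 3) {u : ℝ} (hu : 1 ≤ u + a 3) :
    Real.log ‖RC a b ((u : ℂ) + (y : ℂ) * I)‖ ≤
      Real.log |Pi a b|
      + ((prim y (u + (a 0 - 1 : ℤ)) - prim y (u + b 0)) + halfLog y (u + b 0) + halfLog y (u + (a 0 - 1 : ℤ))
          + (1 + Real.log 2))
      + ((prim y (u + (a 1 - 1 : ℤ)) - prim y (u + b 1)) + halfLog y (u + b 1) + halfLog y (u + (a 1 - 1 : ℤ))
          + (1 + Real.log 2))
      + ((prim y (u + (a 2 - 1 : ℤ)) - prim y (u + b 2)) + halfLog y (u + b 2) + halfLog y (u + (a 2 - 1 : ℤ))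
          + (1 + Real.log 2))
      - (prim y (u + (b 3 - 1 : ℤ)) - prim y (u + a 3 - 1)) := by
  have h0 := hlen 0 (by decide); have h1 := hlen 1 (by decide); have h2 := hlen 2 (by decide)
  rw [log_norm_RC_eq hy a b u, sum_IcoInt_halfLog y u (by omega : b 0 < a 0), sum_IcoInt_halfLog y u (by omega : b 1 < a 1),
    sum_IcoInt_halfLog y u (by omega : b 2 < a 2), sum_IcoInt_halfLog y u hden]
  have k0 := sum_halfLog_le hy (u + (b 0 : ℝ)) (L := (a 0 - 1 - b 0).toNat) (by omega)
  have k1 := sum_halfLog_le hy (u + (b 1 : ℝ)) (L := (a 1 - 1 - b 1).toNat) (by omega)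
  have k2 := sum_halfLog_le hy (u + (b 2 : ℝ)) (L := (a 2 - 1 - b 2).toNat) (by omega)
  have k3 := le_sum_halfLog hy (x₀ := u + (a 3 : ℝ)) (by linarith) ((b 3 - 1 - a 3).toNat)
  have e0 : (u + (b 0 : ℝ)) + (((a 0 - 1 - b 0).toNat : ℕ) : ℝ) = u + ((a 0 - 1 : ℤ) : ℝ) := by
    rw [show (((a 0 - 1 - b 0).toNat : ℕ) : ℝ) = ((a 0 - 1 - b 0 : ℤ) : ℝ) by exact_mod_cast Int.toNat_of_nonneg (by omega)]
    push_cast; ring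
  have e1 : (u + (b 1 : ℝ)) + (((a 1 - 1 - b 1).toNat : ℕ) : ℝ) = u + ((a 1 - 1 : ℤ) : ℝ) := by
    rw [show (((a 1 - 1 - b 1).toNat : ℕ) : ℝ) = ((a 1 - 1 - b 1 : ℤ) : ℝ) by exact_mod_cast Int.toNat_of_nonneg (by omega)]
    push_cast; ring
  have e2 : (u + (b 2 : ℝ)) + (((a 2 - 1 - b 2).toNat : ℕ) : ℝ) = u + ((a 2 - 1 : ℤ) : ℝ) := by
    rw [show (((a 2 - 1 - b 2).toNat : ℕ) : ℝ) = ((a 2 - 1 - b 2 : ℤ) : ℝ) by exact_mod_cast Int.toNat_of_nonneg (by omega)]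
    push_cast; ring
  have e3 : (u + (a 3 : ℝ)) + (((b 3 - 1 - a 3).toNat : ℕ) : ℝ) = u + ((b 3 - 1 : ℤ) : ℝ) := by
    rw [show (((b 3 - 1 - a 3).toNat : ℕ) : ℝ) = ((b 3 - 1 - a 3 : ℤ) : ℝ) by exact_mod_cast Int.toNat_of_nonneg (by omega)]
    push_cast; ring
  rw [e0] at k0; rw [e1] at k1; rw [e2] at k2; rw [e3] at k3
  linarith

end Summit.KontsevichZagierPeriods.Zeta5Search.TwoTaleLineBound

end
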